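import Literature.Probability.Percolation.ArmSeparationRawGoodUp
import Literature.Probability.Percolation.TrapTermFence
import HarnessLib

/-!
# The fence of a term explored from above: the data and its planar position

Topic `Literature/Probability/Percolation`; family `crit-perc` / near-critical percolation on `𝕋`.
A brick of the near-critical arm-separation theorem for four arms in the ADJACENT colour
arrangement (P. Nolin, EJP 13 (2008), Thm. 11, `j = 4`, `σ = BBWW` [arXiv 0711.4948: Thm. 10];
the last missing input `hsepAdj` of `Werner2009_lemma63_of_altSeparation_of_adjSeparation`).

Mirror of `TrapTermFence.lean` for the terms of the exploration from above
(`(trapDomain M).flip`), whose fences (`ArmSeparationFrameBelow.lean`) sit in the lower corner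
box below the tip and whose connections run in `flip.above d z` (sites joined to
`trapB ∪ J_{<z}` avoiding `d`) and, outside `Λ_{2M}`, strictly below the row of the tip:

* `fenceSetUp M d z k ω S` — the admissible sites of the connection; `mem_fenceSetUp_inside`,
  `mem_fenceSetUp_outside`, `fenceSetUp_subset`, `fenceSetUp_disjoint`, `fenceSetUp_box`;
* `TermFenceUp M d z k ω S` — the data (`m`, `q ∈ S`, `p`, tight connection `F`);
  `TrapRawOKUp.nonempty_termFenceUp`;
* `TermFenceUp.exists_exit` — following the connection out of `Λ_{2M}`;
  `TermFenceUp.exit_mem_Jbelow` — the last inside site before an exit is a site of the tip arc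
  strictly BELOW the tip `z` and within `2k + 1` rows of it (bottom-type, and not on `trapB` when
  the tip is at least `2k + 2` rows above the bottom corner).
* `TermFence.exit_mem_Jabove` — the corresponding statement for the fences from below (top-type,
  and not on `trapU` when the tip is at least `2k + 2` rows below the top corner), recorded here
  for the symmetric use of both.

Everything here is proved; no named facts are introduced.

## References

* P. Nolin, Near-critical percolation in two dimensions, *Electron. J. Probab.* 13 (2008), §4.4,
  proof of Lemma 15 (arXiv 0711.4948: Lemma 14) [Nolin2008].
* H. Kesten, *Percolation theory for mathematicians* (1982), §2.3 [KestenPTM1982].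
-/

noncomputable section

open Set

namespace Literature.Probability.Percolation

open LatticeModels

/-! ### The admissible sites of a fence from above -/

/-- **The admissible sites of the connection of the fence of a term `d` from above (tip `z`,
scale `k`) stopped at `S`.** [cite: Nolin2008, §4.4 Lemma 15 (proof) (arXiv 0711.4948: Lemma 14)] -/
def fenceSetUp (M : ℕ) (d : Finset (Site 2)) (z : Site 2) (k : ℕ) (ω : SiteConfig (Site 2)) (S : Set (Site 2)) :
    Set (Site 2) :=
  (trapFrameZoneBelow M z k ∩
    {v | (triNorm v ≤ 2 * M → v ∈ (trapDomain M).flip.above d z) ∧ (2 * (M : ℤ) < triNorm v → v 1 < z 1)}) ∩ ω ∩ Sᶜ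

section FenceSetUp

variable {M k : ℕ} {d : Finset (Site 2)} {z : Site 2} {ω : SiteConfig (Site 2)} {S : Set (Site 2)} {v : Site 2}

/-- Sites of the fence set are open. [folklore] -/
theorem fenceSetUp_subset : fenceSetUp M d z k ω S ⊆ ω := fun _ hv => hv.1.2

/-- Sites of the fence set are off `S`. [folklore] -/
theorem fenceSetUp_disjoint (hv : v ∈ fenceSetUp M d z k ω S) : v ∉ S := hv.2

/-- Sites of the fence set lie in the square of half-width `2k + 1` about `z`. [folklore] -/
theorem fenceSetUp_box (hv : v ∈ fenceSetUp M d z k ω S) :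
    z 0 - (2 * k + 1) ≤ v 0 ∧ v 0 ≤ z 0 + (2 * k + 1) ∧ z 1 - (2 * k + 1) ≤ v 1 ∧ v 1 ≤ z 1 + (2 * k + 1) :=
  (mem_trapFrameZoneBelow.1 hv.1.1.1).2

/-- An inside site of the fence set is a site of the trapezoid in `flip.above d z`, off `d`. [folklore] -/
theorem mem_fenceSetUp_inside (hv : v ∈ fenceSetUp M d z k ω S) (hn : triNorm v ≤ 2 * M) :
    v ∈ trapD M ∧ v ∈ (trapDomain M).flip.above d z ∧ v ∉ d := by
  have ha := hv.1.1.2.1 hn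
  have hT : v ∈ trapD M := by
    rcases (mem_trapFrameZoneBelow.1 hv.1.1.1).1 with h | h
    · exact h
    · omega
  exact ⟨hT, ha, fun hvd => JDomain.not_mem_of_mem_above ha hvd⟩

/-- An outside site of the fence set lies strictly below the row of `z`. [folklore] -/
theorem mem_fenceSetUp_outside (hv : v ∈ fenceSetUp M d z k ω S) (hn : 2 * (M : ℤ) < triNorm v) : v 1 < z 1 :=
  hv.1.1.2.2 hn

end FenceSetUp

/-! ### The data -/

/-- **A fence of the term `d` from above (tip `z`, scale `k`) stopped at `S`** in `ω`. [cite: Nolin2008, §4.4 Lemma 15 (proof) (arXiv 0711.4948: Lemma 14)] -/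
structure TermFenceUp (M : ℕ) (d : Finset (Site 2)) (z : Site 2) (k : ℕ) (ω : SiteConfig (Site 2)) (S : Set (Site 2)) where
  /-- the exterior fence site -/
  m : Site 2
  /-- the attachment site, in `S` -/
  q : Site 2
  /-- the first site of the connection, a neighbour of `q` -/
  p : Site 2
  /-- the sites of the connection -/
  F : Set (Site 2)
  vcross : OpenVCrossThrough (triStrip (z 0 + k) (z 1 - 2 * k) k k) (z 1 - 2 * k) (z 1 - k) ω m
  q_mem : q ∈ S
  adj : triGraph.Adj q p
  F_subset : F ⊆ fenceSetUp M d z k ω S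
  path : PathIn triGraph F p m
  tight : ∀ x ∈ F, PathIn triGraph F p x

namespace TermFenceUp

variable {M k : ℕ} {d : Finset (Site 2)} {z : Site 2} {ω : SiteConfig (Site 2)} {S : Set (Site 2)}
  (T : TermFenceUp M d z k ω S)

/-- `p ∈ F`. [folklore] -/
theorem p_mem : T.p ∈ T.F := T.path.left_mem

/-- `m ∈ F`. [folklore] -/
theorem m_mem : T.m ∈ T.F := T.path.right_mem

/-- Every site of the connection is joined to `m` inside it. [folklore] -/
theorem pathIn_to_m {x : Site 2} (hx : x ∈ T.F) : PathIn triGraph T.F x T.m := (T.tight x hx).symm.trans T.path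

/-- The fence site is outside `Λ_{2M}` (`1 ≤ k`). [folklore] -/
theorem norm_m (hk : 1 ≤ k) (hz : z ∈ trapO M) : 2 * (M : ℤ) < triNorm T.m := by
  obtain ⟨e₁, e₂, -, -, hp, -⟩ := T.vcross
  have hm := (hp.right_mem).1
  rw [mem_triStrip] at hm
  have hz' := trapO_coord hz
  have hk' : (1 : ℤ) ≤ k := by exact_mod_cast hk
  rw [triNorm_eq_max]; simp only [lt_max_iff]; omega

/-- **Following the connection out of `Λ_{2M}`**. [folklore] -/
theorem exists_exit (hk : 1 ≤ k) (hz : z ∈ trapO M) {x : Site 2} (hx : x ∈ T.F) (hxn : triNorm x ≤ 2 * M) :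
    ∃ x' e : Site 2, triNorm x' ≤ 2 * M ∧ 2 * (M : ℤ) < triNorm e ∧ e ∈ T.F ∧ triGraph.Adj x' e ∧
      PathIn triGraph ({v | triNorm v ≤ 2 * M} ∩ T.F) x x' := by
  have hm := T.norm_m hk hz
  obtain ⟨x', e, hx', he, heF, hadj, hpath⟩ :=
    (T.pathIn_to_m hx).exit (R := {v : Site 2 | triNorm v ≤ 2 * M}) hxn (by simp only [Set.mem_setOf_eq, not_le]; exact hm)
  simp only [Set.mem_setOf_eq, not_le] at hx' he
  exact ⟨x', e, hx', he, heF, hadj, hpath⟩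

/-- **The last inside site before an exit is on the tip arc strictly below the tip** (and within
`2k + 1` rows of it): it is a boundary site of the trapezoid in `flip.above d z`, hence bottom-type
for `z`, and not on `trapB` when `-2M + 2k + 1 < z₁`. [cite: KestenPTM1982, §2.3] -/
theorem exit_mem_Jbelow (hd : (trapDomain M).flip.IsCrossing d z) (hzrow : -(2 * (M : ℤ)) + (2 * k + 1) < z 1)
    {x' e : Site 2} (hx'F : x' ∈ T.F) (hx'n : triNorm x' ≤ 2 * M) (hen : 2 * (M : ℤ) < triNorm e)
    (hadj : triGraph.Adj x' e) : x' ∈ trapO M ∧ z 1 - (2 * k + 1) ≤ x' 1 ∧ x' 1 < z 1 := by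
  have hcutf : (trapDomain M).flip.CutProp := JDomain.flip_cutProp (trapDomain_cutProp M)
  have hd' : (trapDomain M).IsCrossing d z := (JDomain.flip_isCrossing_iff _).1 hd
  have hz : z ∈ trapO M := tip_mem_trapO hd'
  obtain ⟨hx'D, hx'a, hx'd⟩ := mem_fenceSetUp_inside (T.F_subset hx'F) hx'n
  have hbox := fenceSetUp_box (T.F_subset hx'F)
  have hx'b : triNorm x' = 2 * M := triNorm_eq_of_adj_exterior hx'D hen hadj
  have hne : x' ≠ z := fun h => hx'd (h ▸ hd.tip_mem)
  rcases sType_or_nType hx'D hx'b hz hne with hS | hN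
  · simp only [Finset.mem_union, trapDomain_Bt, mem_trapDomain_Jbelow] at hS
    rcases hS with hB | ⟨hO, hlt⟩
    · have := (mem_trapB.1 hB).2
      omega
    · exact ⟨hO, by omega, hlt⟩
  · exact absurd hx'a (hd.not_mem_above_of_mem_Bt_union hcutf (mem_flip_Bt_union_iff.2 hN))

end TermFenceUp

/-- **The last inside site before an exit of a fence from below is on the tip arc strictly above
the tip** (and within `2k + 1` rows of it), when `z₁ + 2k + 1 < 0`. [cite: KestenPTM1982, §2.3] -/
theorem TermFence.exit_mem_Jabove {M k : ℕ} {c : Finset (Site 2)} {z : Site 2} {ω : SiteConfig (Site 2)}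
    {S : Set (Site 2)} (T : TermFence M c z k ω S) (hc : (trapDomain M).IsCrossing c z)
    (hzrow : z 1 + (2 * k + 1) < 0) {x' e : Site 2} (hx'F : x' ∈ T.F) (hx'n : triNorm x' ≤ 2 * M)
    (hen : 2 * (M : ℤ) < triNorm e) (hadj : triGraph.Adj x' e) :
    x' ∈ trapO M ∧ z 1 < x' 1 ∧ x' 1 ≤ z 1 + (2 * k + 1) := by
  have hcut := trapDomain_cutProp M
  have hz : z ∈ trapO M := tip_mem_trapO hc
  obtain ⟨hx'D, hx'a, hx'c⟩ := mem_fenceSet_inside (T.F_subset hx'F) hx'n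
  have hbox := fenceSet_box (T.F_subset hx'F)
  have hx'b : triNorm x' = 2 * M := triNorm_eq_of_adj_exterior hx'D hen hadj
  have hne : x' ≠ z := fun h => hx'c (h ▸ hc.tip_mem)
  rcases sType_or_nType hx'D hx'b hz hne with hS | hN
  · exact absurd hx'a (hc.not_mem_above_of_mem_Bt_union hcut hS)
  · simp only [Finset.mem_union, trapDomain_Tp, mem_trapDomain_Jabove] at hN
    rcases hN with hU | ⟨hO, hlt⟩
    · have h1 := (mem_trapU.1 hU).2
      have h2 := mem_trapD.1 hx'D
      omega
    · exact ⟨hO, hlt, by omega⟩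

/-! ### Existence from raw success -/

/-- **A raw-good term from above has a fence stopped at any `S ⊇ d` inside `Λ_{2M}`** (`1 ≤ k`,
`2k + 1 ≤ M`, `-2M < z₁ < 0`). [cite: Nolin2008, §4.4 Lemma 15 (proof) (arXiv 0711.4948: Lemma 14)] [cite: Kesten1987, Lemma 2] -/
theorem TrapRawOKUp.nonempty_termFenceUp {M k : ℕ} {d : Finset (Site 2)} {z : Site 2} {ω : SiteConfig (Site 2)}
    (h : TrapRawOKUp M d z k ω) (hk : 1 ≤ k) (hkM : 2 * (k : ℤ) + 1 ≤ M)
    (hd : (trapDomain M).flip.IsCrossing d z) (hz0 : z 1 < 0) (hzB : -(2 * (M : ℤ)) < z 1)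
    {S : Set (Site 2)} (hdS : (↑d : Set (Site 2)) ⊆ S)
    (hSn : ∀ v ∈ S, triNorm v ≤ 2 * M) : Nonempty (TermFenceUp M d z k ω S) := by
  obtain ⟨m, hV, q, hqS, p, hqp, hpath⟩ := h.exists_fence_below_gen hk hkM hd hz0 hzB hdS hSn
  obtain ⟨F, hF, hp, ht⟩ := hpath.exists_support
  exact ⟨{ m := m, q := q, p := p, F := F, vcross := hV, q_mem := hqS, adj := hqp, F_subset := hF,
           path := hp, tight := ht }⟩

/-- **The connection of a fence from above avoids the arms' tips region**: every inside site of
the connection lies strictly below the tip row plus `2k + 1` — bookkeeping form of `fenceSetUp_box`. [folklore] -/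
theorem TermFenceUp.row_le {M k : ℕ} {d : Finset (Site 2)} {z : Site 2} {ω : SiteConfig (Site 2)}
    {S : Set (Site 2)} (T : TermFenceUp M d z k ω S) {x : Site 2} (hx : x ∈ T.F) : x 1 ≤ z 1 + (2 * k + 1) :=
  (fenceSetUp_box (T.F_subset hx)).2.2.2

end Literature.Probability.Percolation
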